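import Summits.BirchSwinnertonDyer.BirchSwinnertonDyer.Theorems.Rank2Observatory2DescClCertBasic
import Summits.BirchSwinnertonDyer.BirchSwinnertonDyer.Theorems.Rank2Observatory2DescClIndexCert
import HarnessLib

/-!
# BirchSwinnertonDyer — rank ≥ 2 observatory: KERNEL-2DESC-CL v3.0, S1 — ONE-VIEW FRACTIONAL INTEGRAL ELEMENTS

HONEST FRAMING: per-curve certified theorems and census instruments; no claim on BSD in rank ≥ 2.

Generic layer of the KERNEL-2DESC-CL instrument (design `b2b-bsdr2-cert-1/kernel-2desc-cl/v2/generics/v27/noeta/SPLIT2-SPEC.md` §2).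
In a cubic field `K = ℚ(θ)`, `θ³ + aθ² + bθ + c = 0`, whose generator has index `> 1` and which admits NO
monogenic `2`-maximal order (`2` totally split — a common index divisor), elements of `𝓞 K` outside `ℤ[θ]` cannot be
carried by the two-view device.  This file carries them as **fractional one-view elements**
`x = (X₀ + X₁θ + X₂θ²)/m` together with an INTEGRALITY CERTIFICATE: integers `(T, S, N)` such that the coordinate
identity `X³ − T·m·X² + S·m²·X − N·m³ = 0` holds in `ℤ[θ]` (computed with `MonicCubic.mulCoords`).  Then `x` is a
root of the monic cubic `t³ − T t² + S t − N ∈ ℤ[t]`, hence an algebraic integer (`FracElt.toInt`), with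
`m · toInt = lin X` (`natCast_mul_toInt`) and `|N(toInt)| · m³ = |normFormZ X|` (`natAbs_norm_toInt_mul`).
Every check is a `Bool` on integers, closed by `decide` / `rfl` in the per-field files.
Sorry-free; axioms `propext`, `Classical.choice`, `Quot.sound`.
[cite: Marcus2018, Ch. 2, Thm. 4 and Exercise 13] [cite: Cohen1993, §4.8.2]
-/

set_option linter.dupNamespace false

noncomputable section

open scoped Classical NumberField

open Literature.NumberTheory.NumberFields Polynomial Module NumberField

namespace Summit.BirchSwinnertonDyer.BirchSwinnertonDyer.Rank2Observatory.TwoDescCl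

open TwoDescCubic

variable {K : Type*} [Field K] [NumberField K] {a b c : ℤ} {θ : K}

/-- A fractional one-view element `(X₀ + X₁θ + X₂θ²)/m` with its characteristic-polynomial certificate
`(T, S, N)` (trace, second symmetric function, norm). [cite: Cohen1993, §4.8.2] -/
structure FracElt where
  X : ℤ × ℤ × ℤ
  m : ℕ
  T : ℤ
  S : ℤ
  N : ℤ
deriving DecidableEq

namespace FracElt

/-- Integer scalar multiple of a coordinate triple. [folklore] -/
def zsmul (k : ℤ) (u : ℤ × ℤ × ℤ) : ℤ × ℤ × ℤ := (k * u.1, k * u.2.1, k * u.2.2)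

/-- The INTEGRALITY CHECK: `0 < m` and `X³ − T·m·X² + S·m²·X − N·m³·1 = 0` in `ℤ[θ]`-coordinates.
[cite: Cohen1993, §4.8.2] -/
def check (a b c : ℤ) (e : FracElt) : Bool :=
  let X2 := MonicCubic.mulCoords a b c e.X e.X
  let X3 := MonicCubic.mulCoords a b c X2 e.X
  decide (0 < e.m) &&
  (decide (X3.1 - e.T * e.m * X2.1 + e.S * e.m ^ 2 * e.X.1 - e.N * e.m ^ 3 = 0) &&
  (decide (X3.2.1 - e.T * e.m * X2.2.1 + e.S * e.m ^ 2 * e.X.2.1 = 0) &&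
   decide (X3.2.2 - e.T * e.m * X2.2.2 + e.S * e.m ^ 2 * e.X.2.2 = 0)))

/-- The element of `K` named by `e`: `(X₀ + X₁θ + X₂θ²)/m`. [folklore] -/
def val (θ : K) (e : FracElt) : K := MonicCubic.evalCoords θ e.X / (e.m : K)

/-- `m · val = X(θ)`. [folklore] -/
theorem natCast_mul_val (e : FracElt) (hm : 0 < e.m) :
    (e.m : K) * e.val θ = MonicCubic.evalCoords θ e.X := by
  have hm' : (e.m : K) ≠ 0 := Nat.cast_ne_zero.mpr hm.ne'
  rw [val, mul_div_cancel₀ _ hm']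

/-- **Soundness of the integrality check**: `val` is a root of the monic cubic `t³ − T t² + S t − N`.
[cite: Cohen1993, §4.8.2] -/
theorem aeval_val (hθ : aeval θ (MonicCubic.poly a b c) = 0) {e : FracElt} (h : e.check a b c = true) :
    aeval (e.val θ) (MonicCubic.poly (-e.T) e.S (-e.N)) = 0 := by
  simp only [check, Bool.and_eq_true, decide_eq_true_eq] at h
  obtain ⟨hm, h1, h2, h3⟩ := h
  have hm' : (e.m : K) ≠ 0 := Nat.cast_ne_zero.mpr hm.ne'
  have hrel := MonicCubic.theta_rel hθ
  set x := MonicCubic.evalCoords θ e.X with hx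
  have hsq : MonicCubic.evalCoords θ (MonicCubic.mulCoords a b c e.X e.X) = x * x :=
    MonicCubic.evalCoords_mulCoords hrel _ _
  have hcube : MonicCubic.evalCoords θ
      (MonicCubic.mulCoords a b c (MonicCubic.mulCoords a b c e.X e.X) e.X) = x * x * x := by
    rw [MonicCubic.evalCoords_mulCoords hrel, hsq]
  -- the coordinate identity, read in `K`
  have hK : x * x * x - (e.T : K) * (e.m : K) * (x * x) + (e.S : K) * (e.m : K) ^ 2 * x
      - (e.N : K) * (e.m : K) ^ 3 = 0 := by
    rw [← hcube, ← hsq, hx]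
    simp only [MonicCubic.evalCoords]
    have h1' : ((MonicCubic.mulCoords a b c (MonicCubic.mulCoords a b c e.X e.X) e.X).1 : K)
        - (e.T : K) * (e.m : K) * ((MonicCubic.mulCoords a b c e.X e.X).1 : K)
        + (e.S : K) * (e.m : K) ^ 2 * (e.X.1 : K) - (e.N : K) * (e.m : K) ^ 3 = 0 := by
      exact_mod_cast congrArg (fun z : ℤ => (z : K)) h1 |>.trans Int.cast_zero
    have h2' : ((MonicCubic.mulCoords a b c (MonicCubic.mulCoords a b c e.X e.X) e.X).2.1 : K)
        - (e.T : K) * (e.m : K) * ((MonicCubic.mulCoords a b c e.X e.X).2.1 : K)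
        + (e.S : K) * (e.m : K) ^ 2 * (e.X.2.1 : K) = 0 := by
      exact_mod_cast congrArg (fun z : ℤ => (z : K)) h2 |>.trans Int.cast_zero
    have h3' : ((MonicCubic.mulCoords a b c (MonicCubic.mulCoords a b c e.X e.X) e.X).2.2 : K)
        - (e.T : K) * (e.m : K) * ((MonicCubic.mulCoords a b c e.X e.X).2.2 : K)
        + (e.S : K) * (e.m : K) ^ 2 * (e.X.2.2 : K) = 0 := by
      exact_mod_cast congrArg (fun z : ℤ => (z : K)) h3 |>.trans Int.cast_zero
    linear_combination h1' + θ * h2' + θ ^ 2 * h3'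
  have hv : e.val θ = x / (e.m : K) := rfl
  have goal : (e.val θ) ^ 3 + ((-e.T : ℤ) : K) * (e.val θ) ^ 2 + ((e.S : ℤ) : K) * (e.val θ)
      + ((-e.N : ℤ) : K) = 0 := by
    rw [hv]
    push_cast
    field_simp
    linear_combination hK
  have := goal
  simp only [MonicCubic.poly, map_add, map_mul, map_pow, aeval_X, eq_intCast, map_intCast]
  linear_combination this

/-- The certified element of `𝓞 K`. [cite: Cohen1993, §4.8.2] -/
def toInt (hθ : aeval θ (MonicCubic.poly a b c) = 0) (e : FracElt) (h : e.check a b c = true) : 𝓞 K :=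
  MonicCubic.thetaInt (aeval_val hθ h)

/-- `toInt` in `K`. [folklore] -/
@[simp] theorem coe_toInt (hθ : aeval θ (MonicCubic.poly a b c) = 0) (e : FracElt) (h : e.check a b c = true) :
    ((e.toInt hθ h : 𝓞 K) : K) = e.val θ := rfl

/-- `algebraMap` form of `coe_toInt`. [folklore] -/
theorem algebraMap_toInt (hθ : aeval θ (MonicCubic.poly a b c) = 0) (e : FracElt) (h : e.check a b c = true) :
    algebraMap (𝓞 K) K (e.toInt hθ h) = e.val θ := rfl

/-- **`m · toInt = lin X`** in `𝓞 K`. [folklore] -/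
theorem natCast_mul_toInt (hθ : aeval θ (MonicCubic.poly a b c) = 0) (e : FracElt) (h : e.check a b c = true) :
    (e.m : 𝓞 K) * e.toInt hθ h = lin hθ e.X.1 e.X.2.1 e.X.2.2 := by
  have hm : 0 < e.m := by
    simp only [check, Bool.and_eq_true, decide_eq_true_eq] at h; exact h.1
  apply IsFractionRing.injective (𝓞 K) K
  rw [map_mul, map_natCast, algebraMap_toInt, natCast_mul_val e hm, algebraMap_lin]
  simp [MonicCubic.evalCoords]

/-- **Norm**: `|N(toInt)| · m³ = |normFormZ X|`. [cite: Marcus2018, Ch. 2, Thm. 4 and Exercise 13] -/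
theorem natAbs_norm_toInt_mul (hirr : Irreducible (MonicCubic.polyQ a b c))
    (hθ : aeval θ (MonicCubic.poly a b c) = 0) (h3 : finrank ℚ K = 3) (e : FracElt) (h : e.check a b c = true) :
    (Algebra.norm ℤ (e.toInt hθ h)).natAbs * e.m ^ 3 = (normFormZ a b c e.X.1 e.X.2.1 e.X.2.2).natAbs := by
  have hlin := natAbs_norm_lin hirr hθ h3 e.X.1 e.X.2.1 e.X.2.2 (n := normFormZ a b c e.X.1 e.X.2.1 e.X.2.2)
    (by rw [normForm_intCast])
  rw [← natCast_mul_toInt hθ e h, map_mul, Int.natAbs_mul, mul_comm] at hlin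
  have hnm : (Algebra.norm ℤ (e.m : 𝓞 K)).natAbs = e.m ^ 3 := by
    have h0 := Algebra.norm_algebraMap (S := 𝓞 K) (R := ℤ) (e.m : ℤ)
    rw [NumberField.RingOfIntegers.rank, h3, map_natCast] at h0
    rw [h0, Int.natAbs_pow, Int.natAbs_natCast]
  rw [hnm] at hlin
  exact hlin

/-- **Norm valuation input**: if `|normFormZ X| = m³ · n` then `|N(toInt)| = n` — the shape consumed by the
valuation lemmas of `…ClValuation`. [folklore] -/
theorem natAbs_norm_toInt (hirr : Irreducible (MonicCubic.polyQ a b c))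
    (hθ : aeval θ (MonicCubic.poly a b c) = 0) (h3 : finrank ℚ K = 3) (e : FracElt) (h : e.check a b c = true)
    {n : ℕ} (hn : (normFormZ a b c e.X.1 e.X.2.1 e.X.2.2).natAbs = e.m ^ 3 * n) :
    (Algebra.norm ℤ (e.toInt hθ h)).natAbs = n := by
  have hm : 0 < e.m := by
    simp only [check, Bool.and_eq_true, decide_eq_true_eq] at h; exact h.1
  have := natAbs_norm_toInt_mul hirr hθ h3 e h
  rw [hn, mul_comm (e.m ^ 3)] at this
  exact Nat.eq_of_mul_eq_mul_right (pow_pos hm 3) this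

/-! ## Identities between fractional elements, read on coordinates -/

/-- PRODUCT CHECK: `e₁ · e₂ = e₃` as elements, certified by `m₃ · (X₁ X₂) = m₁ m₂ · X₃` on coordinates. [folklore] -/
def mulCheck (a b c : ℤ) (e₁ e₂ e₃ : FracElt) : Bool :=
  decide (zsmul e₃.m (MonicCubic.mulCoords a b c e₁.X e₂.X) = zsmul (e₁.m * e₂.m) e₃.X)

omit [NumberField K] in
/-- `evalCoords` of an integer scalar multiple. [folklore] -/
theorem evalCoords_zsmul (τ : K) (k : ℤ) (u : ℤ × ℤ × ℤ) :
    MonicCubic.evalCoords τ (zsmul k u) = (k : K) * MonicCubic.evalCoords τ u := by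
  simp only [MonicCubic.evalCoords, zsmul]; push_cast; ring

/-- Soundness of the product check in `K`. [folklore] -/
theorem val_mul_of_mulCheck (hθ : aeval θ (MonicCubic.poly a b c) = 0) {e₁ e₂ e₃ : FracElt}
    (h₁ : 0 < e₁.m) (h₂ : 0 < e₂.m) (h₃ : 0 < e₃.m) (h : mulCheck a b c e₁ e₂ e₃ = true) :
    e₁.val θ * e₂.val θ = e₃.val θ := by
  simp only [mulCheck, decide_eq_true_eq] at h
  have hK := congrArg (MonicCubic.evalCoords θ) h
  rw [evalCoords_zsmul, evalCoords_zsmul, MonicCubic.evalCoords_mulCoords (MonicCubic.theta_rel hθ)] at hK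
  have h1' : (e₁.m : K) ≠ 0 := by exact_mod_cast h₁.ne'
  have h2' : (e₂.m : K) ≠ 0 := by exact_mod_cast h₂.ne'
  have h3' : (e₃.m : K) ≠ 0 := by exact_mod_cast h₃.ne'
  simp only [val]
  field_simp
  push_cast at hK
  linear_combination hK

/-- Positivity of the denominator, extracted from `check`. [folklore] -/
theorem m_pos_of_check {e : FracElt} (h : e.check a b c = true) : 0 < e.m := by
  simp only [check, Bool.and_eq_true, decide_eq_true_eq] at h; exact h.1

/-- Soundness of the product check in `𝓞 K`. [folklore] -/
theorem toInt_mul_of_mulCheck (hθ : aeval θ (MonicCubic.poly a b c) = 0) {e₁ e₂ e₃ : FracElt}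
    (c₁ : e₁.check a b c = true) (c₂ : e₂.check a b c = true) (c₃ : e₃.check a b c = true)
    (h : mulCheck a b c e₁ e₂ e₃ = true) :
    e₁.toInt hθ c₁ * e₂.toInt hθ c₂ = e₃.toInt hθ c₃ := by
  apply IsFractionRing.injective (𝓞 K) K
  rw [map_mul, algebraMap_toInt, algebraMap_toInt, algebraMap_toInt]
  exact val_mul_of_mulCheck hθ (m_pos_of_check c₁) (m_pos_of_check c₂) (m_pos_of_check c₃) h

/-- LINEAR CHECK: `e₃ = e₁ · e₂ + k` for an integer `k` (the shape of membership / inverse witnesses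
`x·y − 1 = 2·s + π·t`), certified on coordinates: `m₁ m₂ · X₃ = m₃ · (X₁ X₂) + k m₁ m₂ m₃ · 1`. [folklore] -/
def mulAddIntCheck (a b c : ℤ) (e₁ e₂ : FracElt) (k : ℤ) (e₃ : FracElt) : Bool :=
  decide (zsmul (e₁.m * e₂.m) e₃.X =
    zsmul e₃.m (MonicCubic.mulCoords a b c e₁.X e₂.X) + zsmul (k * e₁.m * e₂.m * e₃.m) (1, 0, 0))

/-- Soundness of the linear check in `K`. [folklore] -/
theorem val_eq_of_mulAddIntCheck (hθ : aeval θ (MonicCubic.poly a b c) = 0) {e₁ e₂ e₃ : FracElt} {k : ℤ}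
    (h₁ : 0 < e₁.m) (h₂ : 0 < e₂.m) (h₃ : 0 < e₃.m) (h : mulAddIntCheck a b c e₁ e₂ k e₃ = true) :
    e₃.val θ = e₁.val θ * e₂.val θ + (k : K) := by
  simp only [mulAddIntCheck, decide_eq_true_eq] at h
  have hK := congrArg (MonicCubic.evalCoords θ) h
  rw [MonicCubic.evalCoords_add, evalCoords_zsmul, evalCoords_zsmul, evalCoords_zsmul,
    MonicCubic.evalCoords_mulCoords (MonicCubic.theta_rel hθ)] at hK
  have h1' : (e₁.m : K) ≠ 0 := by exact_mod_cast h₁.ne'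
  have h2' : (e₂.m : K) ≠ 0 := by exact_mod_cast h₂.ne'
  have h3' : (e₃.m : K) ≠ 0 := by exact_mod_cast h₃.ne'
  simp only [val]
  simp only [MonicCubic.evalCoords] at hK ⊢
  field_simp
  push_cast at hK ⊢
  linear_combination hK

/-- Soundness of the linear check in `𝓞 K`. [folklore] -/
theorem toInt_eq_of_mulAddIntCheck (hθ : aeval θ (MonicCubic.poly a b c) = 0) {e₁ e₂ e₃ : FracElt} {k : ℤ}
    (c₁ : e₁.check a b c = true) (c₂ : e₂.check a b c = true) (c₃ : e₃.check a b c = true)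
    (h : mulAddIntCheck a b c e₁ e₂ k e₃ = true) :
    e₃.toInt hθ c₃ = e₁.toInt hθ c₁ * e₂.toInt hθ c₂ + (k : 𝓞 K) := by
  apply IsFractionRing.injective (𝓞 K) K
  rw [map_add, map_mul, algebraMap_toInt, algebraMap_toInt, algebraMap_toInt, map_intCast]
  exact val_eq_of_mulAddIntCheck hθ (m_pos_of_check c₁) (m_pos_of_check c₂) (m_pos_of_check c₃) h

/-- SCALED PRODUCT CHECK: `e₁ · e₂ = k · e₃` for an integer `k` (e.g. `π₀π₁ · π₂ = 2 · H`), certified on coordinates: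
`m₃ · (X₁ X₂) = k m₁ m₂ · X₃`. [folklore] -/
def mulEqZsmulCheck (a b c : ℤ) (e₁ e₂ : FracElt) (k : ℤ) (e₃ : FracElt) : Bool :=
  decide (zsmul e₃.m (MonicCubic.mulCoords a b c e₁.X e₂.X) = zsmul (k * e₁.m * e₂.m) e₃.X)

/-- Soundness of the scaled product check in `K`. [folklore] -/
theorem val_mul_eq_of_mulEqZsmulCheck (hθ : aeval θ (MonicCubic.poly a b c) = 0) {e₁ e₂ e₃ : FracElt} {k : ℤ}
    (h₁ : 0 < e₁.m) (h₂ : 0 < e₂.m) (h₃ : 0 < e₃.m) (h : mulEqZsmulCheck a b c e₁ e₂ k e₃ = true) :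
    e₁.val θ * e₂.val θ = (k : K) * e₃.val θ := by
  simp only [mulEqZsmulCheck, decide_eq_true_eq] at h
  have hK := congrArg (MonicCubic.evalCoords θ) h
  rw [evalCoords_zsmul, evalCoords_zsmul, MonicCubic.evalCoords_mulCoords (MonicCubic.theta_rel hθ)] at hK
  have h1' : (e₁.m : K) ≠ 0 := Nat.cast_ne_zero.mpr h₁.ne'
  have h2' : (e₂.m : K) ≠ 0 := Nat.cast_ne_zero.mpr h₂.ne'
  have h3' : (e₃.m : K) ≠ 0 := Nat.cast_ne_zero.mpr h₃.ne'
  simp only [val]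
  field_simp
  push_cast at hK
  linear_combination hK

/-- Soundness of the scaled product check in `𝓞 K`. [folklore] -/
theorem toInt_mul_eq_of_mulEqZsmulCheck (hθ : aeval θ (MonicCubic.poly a b c) = 0) {e₁ e₂ e₃ : FracElt} {k : ℤ}
    (c₁ : e₁.check a b c = true) (c₂ : e₂.check a b c = true) (c₃ : e₃.check a b c = true)
    (h : mulEqZsmulCheck a b c e₁ e₂ k e₃ = true) :
    e₁.toInt hθ c₁ * e₂.toInt hθ c₂ = (k : 𝓞 K) * e₃.toInt hθ c₃ := by
  apply IsFractionRing.injective (𝓞 K) K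
  rw [map_mul, map_mul, algebraMap_toInt, algebraMap_toInt, algebraMap_toInt, map_intCast]
  exact val_mul_eq_of_mulEqZsmulCheck hθ (m_pos_of_check c₁) (m_pos_of_check c₂) (m_pos_of_check c₃) h

/-- IDEAL-MEMBERSHIP WITNESS CHECK: `x − k = p·s + g·t` for a natural number `p`, an integer `k` and fractional
elements `x g s t` (`k = 0`: `x ∈ (p, g)`; `k = 1`: `x·1 − 1 ∈ (p, g)`, i.e. `x ∉ 𝔭` for a prime `𝔭 ⊇ (p, g)`),
certified on coordinates after clearing the denominators `mₓ m_s m_g m_t`. [folklore] -/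
def linCheck (a b c : ℤ) (p : ℕ) (k : ℤ) (x g s t : FracElt) : Bool :=
  decide (zsmul ((s.m : ℤ) * g.m * t.m) x.X - zsmul (k * x.m * s.m * g.m * t.m) (1, 0, 0) =
    zsmul ((p : ℤ) * x.m * g.m * t.m) s.X + zsmul ((x.m : ℤ) * s.m) (MonicCubic.mulCoords a b c g.X t.X))

omit [NumberField K] in
/-- `evalCoords` of a difference. [folklore] -/
theorem evalCoords_sub (τ : K) (u v : ℤ × ℤ × ℤ) :
    MonicCubic.evalCoords τ (u - v) = MonicCubic.evalCoords τ u - MonicCubic.evalCoords τ v := by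
  simp only [MonicCubic.evalCoords, Prod.fst_sub, Prod.snd_sub]; push_cast; ring

/-- Soundness of the witness check in `K`. [folklore] -/
theorem val_eq_of_linCheck (hθ : aeval θ (MonicCubic.poly a b c) = 0) {p : ℕ} {k : ℤ} {x g s t : FracElt}
    (hx : 0 < x.m) (hg : 0 < g.m) (hs : 0 < s.m) (ht : 0 < t.m) (h : linCheck a b c p k x g s t = true) :
    x.val θ - (k : K) = (p : K) * s.val θ + g.val θ * t.val θ := by
  simp only [linCheck, decide_eq_true_eq] at h
  have hK := congrArg (MonicCubic.evalCoords θ) h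
  rw [evalCoords_sub, MonicCubic.evalCoords_add, evalCoords_zsmul, evalCoords_zsmul, evalCoords_zsmul,
    evalCoords_zsmul, MonicCubic.evalCoords_mulCoords (MonicCubic.theta_rel hθ)] at hK
  have hx' : (x.m : K) ≠ 0 := Nat.cast_ne_zero.mpr hx.ne'
  have hg' : (g.m : K) ≠ 0 := Nat.cast_ne_zero.mpr hg.ne'
  have hs' : (s.m : K) ≠ 0 := Nat.cast_ne_zero.mpr hs.ne'
  have ht' : (t.m : K) ≠ 0 := Nat.cast_ne_zero.mpr ht.ne'
  simp only [val]
  simp only [MonicCubic.evalCoords] at hK ⊢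
  field_simp
  push_cast at hK ⊢
  linear_combination hK

/-- Soundness of the witness check in `𝓞 K`: `x − k = p·s + g·t`. [folklore] -/
theorem toInt_eq_of_linCheck (hθ : aeval θ (MonicCubic.poly a b c) = 0) {p : ℕ} {k : ℤ} {x g s t : FracElt}
    (cx : x.check a b c = true) (cg : g.check a b c = true) (cs : s.check a b c = true)
    (ct : t.check a b c = true) (h : linCheck a b c p k x g s t = true) :
    x.toInt hθ cx - (k : 𝓞 K) = (p : 𝓞 K) * s.toInt hθ cs + g.toInt hθ cg * t.toInt hθ ct := by
  apply IsFractionRing.injective (𝓞 K) K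
  rw [map_sub, map_add, map_mul, map_mul, algebraMap_toInt, algebraMap_toInt, algebraMap_toInt,
    algebraMap_toInt, map_intCast, map_natCast]
  exact val_eq_of_linCheck hθ (m_pos_of_check cx) (m_pos_of_check cg) (m_pos_of_check cs) (m_pos_of_check ct) h

/-- **Membership form**: `x − k ∈ (p, g)`. [folklore] -/
theorem sub_mem_span_pair_of_linCheck (hθ : aeval θ (MonicCubic.poly a b c) = 0) {p : ℕ} {k : ℤ}
    {x g s t : FracElt} (cx : x.check a b c = true) (cg : g.check a b c = true) (cs : s.check a b c = true)
    (ct : t.check a b c = true) (h : linCheck a b c p k x g s t = true) :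
    x.toInt hθ cx - (k : 𝓞 K) ∈ Ideal.span {(p : 𝓞 K), g.toInt hθ cg} := by
  rw [toInt_eq_of_linCheck hθ cx cg cs ct h, Ideal.mem_span_pair]
  exact ⟨s.toInt hθ cs, t.toInt hθ ct, by ring⟩

end FracElt

end Summit.BirchSwinnertonDyer.BirchSwinnertonDyer.Rank2Observatory.TwoDescCl
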